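import Mathlib.Analysis.Normed.Operator.Banach
import Mathlib.Topology.Algebra.Module.Equiv
import HarnessLib

/-!
# Bijectivity of bordered block-triangular operators

Elementary bookkeeping for implicit-function-theorem linearisations that are upper triangular in
a splitting of the unknowns: if `(T₁, Λ₁) : Y₁ → Z₁ × G₁` and `(T₂, Λ₂) : Y₂ → Z₂ × G₂` are
bijective (each diagonal block bordered by its own finite set of linear conditions), then for ANY
coupling `M : Y₂ → Z₁` the bordered block-triangular map

  `(y₁, y₂) ↦ ((T₁ y₁ + M y₂, T₂ y₂), (Λ₁ y₁, Λ₂ y₂))`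

is bijective (`bijective_blockTriangular`), and between Banach spaces it is a linear homeomorphism
(`blockTriangularEquiv`, Banach open mapping theorem). Back substitution: solve the second row,
then the first.

Use (lead of crux `WitnessCharge`, summit `SmoothPoincare4`): the linearisation of the
`J`-holomorphic sphere equation at an embedded sphere splits as `[[∂̄_T, M], [0, ∂̄_N + A]]`
(tangential/normal), bordered by the three-point slice on the tangential part and a point
evaluation on the normal part (Wendl 2018, proof of Thm. 2.46).

## References

* C. Wendl, *Holomorphic Curves in Low Dimensions*, LNM 2216 (2018), Thm. 2.46. [Wendl2018]
-/

noncomputable section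

namespace Literature.Analysis.Calculus

section Algebra

variable {R : Type*} [Semiring R]
  {Y₁ Y₂ Z₁ Z₂ G₁ G₂ : Type*}
  [AddCommMonoid Y₁] [AddCommMonoid Y₂] [AddCommGroup Z₁] [AddCommMonoid Z₂]
  [AddCommMonoid G₁] [AddCommMonoid G₂]
  [Module R Y₁] [Module R Y₂] [Module R Z₁] [Module R Z₂] [Module R G₁] [Module R G₂]

/-- **Back substitution**: a bordered block-triangular linear system with bijective bordered
diagonal blocks is uniquely solvable, for any coupling `M`. [folklore] -/
theorem bijective_blockTriangular (T₁ : Y₁ →ₗ[R] Z₁) (Λ₁ : Y₁ →ₗ[R] G₁) (T₂ : Y₂ →ₗ[R] Z₂)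
    (Λ₂ : Y₂ →ₗ[R] G₂) (M : Y₂ →ₗ[R] Z₁)
    (h₁ : Function.Bijective fun y : Y₁ => (T₁ y, Λ₁ y))
    (h₂ : Function.Bijective fun y : Y₂ => (T₂ y, Λ₂ y)) :
    Function.Bijective fun y : Y₁ × Y₂ => ((T₁ y.1 + M y.2, T₂ y.2), (Λ₁ y.1, Λ₂ y.2)) := by
  constructor
  · rintro ⟨y₁, y₂⟩ ⟨y₁', y₂'⟩ h
    simp only [Prod.mk.injEq] at h
    obtain ⟨⟨hT, hT₂⟩, hΛ₁, hΛ₂⟩ := h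
    have hy₂ : y₂ = y₂' := h₂.1 (Prod.ext hT₂ hΛ₂)
    subst hy₂
    have hy₁ : y₁ = y₁' := h₁.1 (Prod.ext (add_right_cancel hT) hΛ₁)
    subst hy₁
    rfl
  · rintro ⟨⟨z₁, z₂⟩, g₁, g₂⟩
    obtain ⟨y₂, hy₂⟩ := h₂.2 (z₂, g₂)
    obtain ⟨y₁, hy₁⟩ := h₁.2 (z₁ - M y₂, g₁)
    simp only [Prod.mk.injEq] at hy₁ hy₂
    refine ⟨(y₁, y₂), ?_⟩
    simp only [hy₁.1, hy₁.2, hy₂.1, hy₂.2, sub_add_cancel]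

end Algebra

section Banach

variable {Y₁ Y₂ Z₁ Z₂ G₁ G₂ : Type*}
  [NormedAddCommGroup Y₁] [NormedSpace ℝ Y₁] [NormedAddCommGroup Y₂] [NormedSpace ℝ Y₂]
  [NormedAddCommGroup Z₁] [NormedSpace ℝ Z₁] [NormedAddCommGroup Z₂] [NormedSpace ℝ Z₂]
  [NormedAddCommGroup G₁] [NormedSpace ℝ G₁] [NormedAddCommGroup G₂] [NormedSpace ℝ G₂]

/-- The bordered block-triangular operator as a continuous linear map
`Y₁ × Y₂ →L (Z₁ × Z₂) × (G₁ × G₂)`. [folklore] -/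
def blockTriangular (T₁ : Y₁ →L[ℝ] Z₁) (Λ₁ : Y₁ →L[ℝ] G₁) (T₂ : Y₂ →L[ℝ] Z₂) (Λ₂ : Y₂ →L[ℝ] G₂)
    (M : Y₂ →L[ℝ] Z₁) : Y₁ × Y₂ →L[ℝ] (Z₁ × Z₂) × (G₁ × G₂) :=
  ((T₁.comp (ContinuousLinearMap.fst ℝ Y₁ Y₂) + M.comp (ContinuousLinearMap.snd ℝ Y₁ Y₂)).prod
      (T₂.comp (ContinuousLinearMap.snd ℝ Y₁ Y₂))).prod
    ((Λ₁.comp (ContinuousLinearMap.fst ℝ Y₁ Y₂)).prod (Λ₂.comp (ContinuousLinearMap.snd ℝ Y₁ Y₂)))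

/-- Pointwise formula for `blockTriangular`. [folklore] -/
@[simp] theorem blockTriangular_apply (T₁ : Y₁ →L[ℝ] Z₁) (Λ₁ : Y₁ →L[ℝ] G₁) (T₂ : Y₂ →L[ℝ] Z₂)
    (Λ₂ : Y₂ →L[ℝ] G₂) (M : Y₂ →L[ℝ] Z₁) (y : Y₁ × Y₂) :
    blockTriangular T₁ Λ₁ T₂ Λ₂ M y = ((T₁ y.1 + M y.2, T₂ y.2), (Λ₁ y.1, Λ₂ y.2)) := rfl

/-- `blockTriangular` is bijective when the bordered diagonal blocks are. [folklore] -/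
theorem bijective_blockTriangular_clm (T₁ : Y₁ →L[ℝ] Z₁) (Λ₁ : Y₁ →L[ℝ] G₁) (T₂ : Y₂ →L[ℝ] Z₂)
    (Λ₂ : Y₂ →L[ℝ] G₂) (M : Y₂ →L[ℝ] Z₁)
    (h₁ : Function.Bijective fun y : Y₁ => (T₁ y, Λ₁ y))
    (h₂ : Function.Bijective fun y : Y₂ => (T₂ y, Λ₂ y)) :
    Function.Bijective (blockTriangular T₁ Λ₁ T₂ Λ₂ M) :=
  bijective_blockTriangular (T₁ : Y₁ →ₗ[ℝ] Z₁) (Λ₁ : Y₁ →ₗ[ℝ] G₁) (T₂ : Y₂ →ₗ[ℝ] Z₂)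
    (Λ₂ : Y₂ →ₗ[ℝ] G₂) (M : Y₂ →ₗ[ℝ] Z₁) h₁ h₂

/-- **The bordered block-triangular operator as a linear homeomorphism** (Banach open mapping
theorem). [folklore] -/
def blockTriangularEquiv [CompleteSpace Y₁] [CompleteSpace Y₂]
    [CompleteSpace Z₁] [CompleteSpace Z₂] [CompleteSpace G₁] [CompleteSpace G₂]
    (T₁ : Y₁ →L[ℝ] Z₁) (Λ₁ : Y₁ →L[ℝ] G₁) (T₂ : Y₂ →L[ℝ] Z₂)
    (Λ₂ : Y₂ →L[ℝ] G₂) (M : Y₂ →L[ℝ] Z₁)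
    (h₁ : Function.Bijective fun y : Y₁ => (T₁ y, Λ₁ y))
    (h₂ : Function.Bijective fun y : Y₂ => (T₂ y, Λ₂ y)) :
    (Y₁ × Y₂) ≃L[ℝ] (Z₁ × Z₂) × (G₁ × G₂) :=
  ContinuousLinearEquiv.ofBijective (blockTriangular T₁ Λ₁ T₂ Λ₂ M)
    (LinearMap.ker_eq_bot.2 (bijective_blockTriangular_clm T₁ Λ₁ T₂ Λ₂ M h₁ h₂).1)
    (LinearMap.range_eq_top.2 (bijective_blockTriangular_clm T₁ Λ₁ T₂ Λ₂ M h₁ h₂).2)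

/-- The equivalence coerces to `blockTriangular`. [folklore] -/
@[simp] theorem coe_blockTriangularEquiv [CompleteSpace Y₁] [CompleteSpace Y₂]
    [CompleteSpace Z₁] [CompleteSpace Z₂] [CompleteSpace G₁] [CompleteSpace G₂]
    (T₁ : Y₁ →L[ℝ] Z₁) (Λ₁ : Y₁ →L[ℝ] G₁) (T₂ : Y₂ →L[ℝ] Z₂)
    (Λ₂ : Y₂ →L[ℝ] G₂) (M : Y₂ →L[ℝ] Z₁)
    (h₁ : Function.Bijective fun y : Y₁ => (T₁ y, Λ₁ y))
    (h₂ : Function.Bijective fun y : Y₂ => (T₂ y, Λ₂ y)) :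
    (blockTriangularEquiv T₁ Λ₁ T₂ Λ₂ M h₁ h₂ : Y₁ × Y₂ →L[ℝ] (Z₁ × Z₂) × (G₁ × G₂)) =
      blockTriangular T₁ Λ₁ T₂ Λ₂ M := rfl

/-- The equivalence applied. [folklore] -/
@[simp] theorem blockTriangularEquiv_apply [CompleteSpace Y₁] [CompleteSpace Y₂]
    [CompleteSpace Z₁] [CompleteSpace Z₂] [CompleteSpace G₁] [CompleteSpace G₂]
    (T₁ : Y₁ →L[ℝ] Z₁) (Λ₁ : Y₁ →L[ℝ] G₁) (T₂ : Y₂ →L[ℝ] Z₂)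
    (Λ₂ : Y₂ →L[ℝ] G₂) (M : Y₂ →L[ℝ] Z₁)
    (h₁ : Function.Bijective fun y : Y₁ => (T₁ y, Λ₁ y))
    (h₂ : Function.Bijective fun y : Y₂ => (T₂ y, Λ₂ y)) (y : Y₁ × Y₂) :
    blockTriangularEquiv T₁ Λ₁ T₂ Λ₂ M h₁ h₂ y = ((T₁ y.1 + M y.2, T₂ y.2), (Λ₁ y.1, Λ₂ y.2)) := rfl

/-- Reading off the normal component of the inverse: if `blockTriangularEquiv … y = ((z₁, z₂), (g₁, g₂))`
then `(T₂ y.2, Λ₂ y.2) = (z₂, g₂)` — the second unknown is determined by the second row alone.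
[folklore] -/
theorem snd_blockTriangularEquiv_symm [CompleteSpace Y₁] [CompleteSpace Y₂]
    [CompleteSpace Z₁] [CompleteSpace Z₂] [CompleteSpace G₁] [CompleteSpace G₂]
    (T₁ : Y₁ →L[ℝ] Z₁) (Λ₁ : Y₁ →L[ℝ] G₁) (T₂ : Y₂ →L[ℝ] Z₂)
    (Λ₂ : Y₂ →L[ℝ] G₂) (M : Y₂ →L[ℝ] Z₁)
    (h₁ : Function.Bijective fun y : Y₁ => (T₁ y, Λ₁ y))
    (h₂ : Function.Bijective fun y : Y₂ => (T₂ y, Λ₂ y)) (q : (Z₁ × Z₂) × (G₁ × G₂)) :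
    (T₂ ((blockTriangularEquiv T₁ Λ₁ T₂ Λ₂ M h₁ h₂).symm q).2,
      Λ₂ ((blockTriangularEquiv T₁ Λ₁ T₂ Λ₂ M h₁ h₂).symm q).2) = (q.1.2, q.2.2) := by
  have h := (blockTriangularEquiv T₁ Λ₁ T₂ Λ₂ M h₁ h₂).apply_symm_apply q
  rw [blockTriangularEquiv_apply] at h
  have h' := congrArg (fun p : (Z₁ × Z₂) × (G₁ × G₂) => (p.1.2, p.2.2)) h
  simpa using h'

end Banach

end Literature.Analysis.Calculus

end
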